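import Summits.QuantumFields.YangMills.Theorems.FluctuationComparisonRegPrIntLS2BetaInterBlock
import Summits.QuantumFields.YangMills.Theorems.FluctuationComparisonRegPrIntLS2BetaResidualGauge
import Summits.QuantumFields.YangMills.Theorems.FluctuationComparisonRegPrIntLS2BetaFlatGapOfIsolated
import HarnessLib

/-!
# hFlat MAY BE PROVED INSIDE THE SUP TUBE: «WLOG every bond of `U` is within `δ` of `1`» — the flat sup tube is already in the tree, and the orbit functional is blind to residual regauging
# (crux `FluctuationComparisonRegPrIntL`, stmt-QuantumFields-20520; registry v11.4 `Cruxes/FluctuationComparisonRegPrIntL/Lines/semiclassical_s2beta.lean` 3732b7df FROZEN, untouched)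

Cell `ym3-torus` (YM ladder rung R3 = continuum `SU(2)` Yang–Mills on the three-torus — a RUNG: NOT d = 4, NOT infinite volume, NOT a mass gap, NOT Clay).
Width seat `ym3-torus-px12` (gen 22); `--kind proof --supports stmt-QuantumFields-20520 --as helper`, count-neutral, DEFINITION-FREE (0 `def`, 0 `instance`,
0 `notation`, 0 `sorry`, default heartbeats).

WHY.  The depth-uniform flat growth letter `hFlat` (third hypothesis of ✓p811100 px16 g19 (D10), text below VERBATIM) is the target of the lane's «hFlat road» (HOME note
`ym3-torus-px12/g22/HFLAT-ROAD-AFTER-6.px12g22.md` §7; px8 g21 UV3-NODE §57).  Two tree facts make its pen's life easier and are packaged here: (1) ✓`…S2BetaInterBlock.closePair_holds` (px8 g18) with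
`U′ := 1` IS the flat SUP tube — every good history over the flat datum is, after a RESIDUAL gauge transformation, bondwise `δ`-close to `1`, for every `δ > 0`, `K`-uniformly (§1); (2) the orbit
functional `⨅_{w residual} Σ_ℓ dist1(U ℓ·((w • 1) ℓ)⁻¹)²`, the action, the fibre of `1` and `histGood` are blind to residual regauging (w5 g22's ✓`…S2BetaResidualGauge`) (§2).  Hence (§3) hFlat follows
from its IN-TUBE edition: the same text with the extra hypothesis «`∀ ℓ, dist1 (U ℓ) ≤ δ`» for a `δ > 0` the pen may choose FIRST (before `pS, ε₁, γ₁, μ`).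

WHAT.  §1 ★ `flatSupTube`.  §2 `sum_dist1_regauge_eq` (the orbit-functional summand after regauging by a residual `w⁻¹` is the summand at `w·v`), ★ `iInf_orbit_le_iInf_orbit_regauge`.
§3 ★★★ `hFlat_of_inTube : ⟨hFlat-in-the-tube⟩ → ⟨hFlat VERBATIM⟩`.

HONEST: quantifier∕invariance bookkeeping over landed letters; the in-tube letter is NOT proved here (it is the road's target); nothing of Bałaban's analysis; hFlat, TUBE-REG∘, GAP♯∘, EXW∘, S2β,
crux 20520 NOT proved; no registered stub is closed; rung R3 = SU(2) YM₃ on T³ — NOT d = 4, NOT infinite volume, NOT a mass gap, NOT Clay; the Yang–Mills mass gap is NOT proved.  Sorry-free, axioms standard.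

References: T. Bałaban, CMP **99** (1985) 75–102 [Balaban1985RegularSpaces] (Lemma 1 (1.24)–(1.26) pp.79–80); CMP **102** (1985) 255–275 [Balaban1985UV3] ((12)–(13) p.259); CMP **96** (1984)
223–250 [Balaban1984PropagatorsII] ((1.33)); [Balaban1985Variational] (4) p.278.
-/

set_option autoImplicit false

noncomputable section

namespace Summit.QuantumFields.YangMills.Theorems.FluctuationComparisonRegPrIntLS2BetaFlatTubeWLOG

open Literature.MathematicalPhysics.QuantumFieldTheory.Balaban1983to89
open T4Continuum T3ContinuumYM3Torus T3UnitScaleTilt T3TiltDescent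
open T3UnitLawDensityEML (ℰp)
open T3ConstrainedMinimiser (fibre)
open T3PrintedRegularMinimiser (minActionRegPr)
open T3DescentFibreTower (one_mem_fibre_one expMeanLogSU_E_one)
open Summit.QuantumFields.YangMills.Theorems.FluctuationComparisonRegPrIntLS2BetaInterBlock (closePair_holds)
open Summit.QuantumFields.YangMills.Theorems.FluctuationComparisonRegPrIntLS2BetaResidualGauge
  (residual_mul residual_inv gaugeAct_mem_fibre_iff_of_residual gaugeAct_mem_histGood_iff wilsonAction4_gaugeAct)
open Summit.QuantumFields.YangMills.Theorems.FluctuationComparisonRegPrIntLS2BetaFlatGapOfIsolated (one_mem_histGood_θBal)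

open scoped Matrix.Norms.L2Operator

/-! ## §1 The flat sup tube (CLOSE-PAIR∘ with `U′ = 1`) -/

/-- ★ **THE FLAT SUP TUBE**: for `L`, `b₀, p₀ > 0` and every `δ > 0` there is `γ₁ > 0` such that for `γ ≤ γ₁` every good history over the flat datum admits a RESIDUAL `w` with
`dist1 (U ℓ·((w • 1) ℓ)⁻¹) ≤ δ` for ALL bonds `ℓ` — depth- and volume-uniformly (✓`closePair_holds` with `U′ := 1`, which is a good history over `1`).
[cite: Balaban1985RegularSpaces, Lemma 1 (1.24)-(1.26) pp.79-80; Balaban1985UV3, (12)-(13) p.259] -/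
theorem flatSupTube (L : ℕ) (b₀ p₀ : ℝ) (hb : 0 < b₀) (hp : 0 < p₀) (δ : ℝ) (hδ : 0 < δ) :
    ∃ γ₁ : ℝ, 0 < γ₁ ∧ ∀ (F : T3Family) (γ : ℝ), F.L = L → 0 < γ → γ ≤ γ₁ →
      ∀ (J K : ℕ) (hJK : J ≤ K),
        ∀ U ∈ fibre F ℰp J K hJK (1 : GaugeField (F.P J) 0 (Matrix.specialUnitaryGroup (Fin 2) ℂ)), U ∈ histGood F ℰp (θBal F.L γ b₀ p₀) K J →
          ∃ w : Site (F.P K) 0 → Matrix.specialUnitaryGroup (Fin 2) ℂ,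
            (∀ U'' : GaugeField (F.P K) 0 (Matrix.specialUnitaryGroup (Fin 2) ℂ),
                descendTo F ℰp J K hJK (GaugeField.gaugeAct w U'') = descendTo F ℰp J K hJK U'') ∧
              ∀ ℓ : PBond (F.P K) 0, dist1 (U ℓ * ((GaugeField.gaugeAct w (1 : GaugeField (F.P K) 0 (Matrix.specialUnitaryGroup (Fin 2) ℂ))) ℓ)⁻¹) ≤ δ := by
  obtain ⟨γ₁, hγ₁, h⟩ := closePair_holds L b₀ p₀ hb hp δ hδ
  refine ⟨min γ₁ 1, lt_min hγ₁ one_pos, fun F γ hFL hγ hγle J K hJK U hU hUg => ?_⟩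
  exact h F γ hFL hγ (hγle.trans (min_le_left _ _)) J K hJK 1 _ (one_mem_fibre_one F ℰp expMeanLogSU_E_one hJK)
    (one_mem_histGood_θBal F hγ (hγle.trans (min_le_right _ _)) hb p₀ K J) U hU hUg

/-! ## §2 The orbit functional is blind to residual regauging -/

variable (F : T3Family) {J K : ℕ} (hJK : J ≤ K)

/-- Regauging by `w⁻¹` moves the comparison transformation: `dist1((w⁻¹ • U) ℓ·((v • 1) ℓ)⁻¹) = dist1(U ℓ·(((w·v) • 1) ℓ)⁻¹)` (conjugation invariance). [cite: Balaban1985Variational, (4) p.278] -/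
theorem dist1_regauge_eq (U : GaugeField (F.P K) 0 (Matrix.specialUnitaryGroup (Fin 2) ℂ)) (w v : Site (F.P K) 0 → Matrix.specialUnitaryGroup (Fin 2) ℂ) (ℓ : PBond (F.P K) 0) :
    dist1 (GaugeField.gaugeAct (w⁻¹ : Site (F.P K) 0 → Matrix.specialUnitaryGroup (Fin 2) ℂ) U ℓ * ((GaugeField.gaugeAct v (1 : GaugeField (F.P K) 0 (Matrix.specialUnitaryGroup (Fin 2) ℂ))) ℓ)⁻¹) =
      dist1 (U ℓ * ((GaugeField.gaugeAct ((w * v : Site (F.P K) 0 → Matrix.specialUnitaryGroup (Fin 2) ℂ)) (1 : GaugeField (F.P K) 0 (Matrix.specialUnitaryGroup (Fin 2) ℂ))) ℓ)⁻¹) := by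
  have e : GaugeField.gaugeAct (w⁻¹ : Site (F.P K) 0 → Matrix.specialUnitaryGroup (Fin 2) ℂ) U ℓ * ((GaugeField.gaugeAct v (1 : GaugeField (F.P K) 0 (Matrix.specialUnitaryGroup (Fin 2) ℂ))) ℓ)⁻¹ =
      (w ℓ.src)⁻¹ * (U ℓ * ((GaugeField.gaugeAct ((w * v : Site (F.P K) 0 → Matrix.specialUnitaryGroup (Fin 2) ℂ)) (1 : GaugeField (F.P K) 0 (Matrix.specialUnitaryGroup (Fin 2) ℂ))) ℓ)⁻¹) * ((w ℓ.src)⁻¹)⁻¹ := by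
    show (w ℓ.src)⁻¹ * U ℓ * ((w ℓ.tgt)⁻¹)⁻¹ * (v ℓ.src * 1 * (v ℓ.tgt)⁻¹)⁻¹ =
      (w ℓ.src)⁻¹ * (U ℓ * ((w ℓ.src * v ℓ.src) * 1 * (w ℓ.tgt * v ℓ.tgt)⁻¹)⁻¹) * ((w ℓ.src)⁻¹)⁻¹
    group
  rw [e, GaugeGroup.dist1_conj]

/-- ★ **THE ORBIT FUNCTIONAL OF `U` IS AT MOST THAT OF ITS RESIDUAL REGAUGING `w⁻¹ • U`** (in fact equal; `≤` is what the door needs): the residual transformations form a group.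
[cite: Balaban1985Variational, (4) p.278] -/
theorem iInf_orbit_le_iInf_orbit_regauge (U : GaugeField (F.P K) 0 (Matrix.specialUnitaryGroup (Fin 2) ℂ)) {w : Site (F.P K) 0 → Matrix.specialUnitaryGroup (Fin 2) ℂ}
    (hw : ∀ U'' : GaugeField (F.P K) 0 (Matrix.specialUnitaryGroup (Fin 2) ℂ), descendTo F ℰp J K hJK (GaugeField.gaugeAct w U'') = descendTo F ℰp J K hJK U'') :
    (⨅ v : {v : Site (F.P K) 0 → Matrix.specialUnitaryGroup (Fin 2) ℂ |
        ∀ U'' : GaugeField (F.P K) 0 (Matrix.specialUnitaryGroup (Fin 2) ℂ), descendTo F ℰp J K hJK (GaugeField.gaugeAct v U'') = descendTo F ℰp J K hJK U''},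
      ∑ ℓ : PBond (F.P K) 0, dist1 (U ℓ * ((GaugeField.gaugeAct (v : Site (F.P K) 0 → Matrix.specialUnitaryGroup (Fin 2) ℂ)
        (1 : GaugeField (F.P K) 0 (Matrix.specialUnitaryGroup (Fin 2) ℂ))) ℓ)⁻¹) ^ 2) ≤
    (⨅ v : {v : Site (F.P K) 0 → Matrix.specialUnitaryGroup (Fin 2) ℂ |
        ∀ U'' : GaugeField (F.P K) 0 (Matrix.specialUnitaryGroup (Fin 2) ℂ), descendTo F ℰp J K hJK (GaugeField.gaugeAct v U'') = descendTo F ℰp J K hJK U''},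
      ∑ ℓ : PBond (F.P K) 0, dist1 (GaugeField.gaugeAct (w⁻¹ : Site (F.P K) 0 → Matrix.specialUnitaryGroup (Fin 2) ℂ) U ℓ * ((GaugeField.gaugeAct (v : Site (F.P K) 0 → Matrix.specialUnitaryGroup (Fin 2) ℂ)
        (1 : GaugeField (F.P K) 0 (Matrix.specialUnitaryGroup (Fin 2) ℂ))) ℓ)⁻¹) ^ 2) := by
  haveI : Nonempty {v : Site (F.P K) 0 → Matrix.specialUnitaryGroup (Fin 2) ℂ |
      ∀ U'' : GaugeField (F.P K) 0 (Matrix.specialUnitaryGroup (Fin 2) ℂ), descendTo F ℰp J K hJK (GaugeField.gaugeAct v U'') = descendTo F ℰp J K hJK U''} :=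
    ⟨⟨w, hw⟩⟩
  refine le_ciInf fun v => ?_
  have hwv := residual_mul F hJK hw v.2
  calc _ ≤ ∑ ℓ : PBond (F.P K) 0, dist1 (U ℓ * ((GaugeField.gaugeAct ((w * (v : Site (F.P K) 0 → Matrix.specialUnitaryGroup (Fin 2) ℂ) : Site (F.P K) 0 → Matrix.specialUnitaryGroup (Fin 2) ℂ))
          (1 : GaugeField (F.P K) 0 (Matrix.specialUnitaryGroup (Fin 2) ℂ))) ℓ)⁻¹) ^ 2 := by
        refine ciInf_le ⟨0, ?_⟩ (⟨w * (v : Site (F.P K) 0 → Matrix.specialUnitaryGroup (Fin 2) ℂ), hwv⟩ :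
          {v : Site (F.P K) 0 → Matrix.specialUnitaryGroup (Fin 2) ℂ |
            ∀ U'' : GaugeField (F.P K) 0 (Matrix.specialUnitaryGroup (Fin 2) ℂ), descendTo F ℰp J K hJK (GaugeField.gaugeAct v U'') = descendTo F ℰp J K hJK U''})
        rintro _ ⟨v', rfl⟩
        exact Finset.sum_nonneg fun _ _ => sq_nonneg _
    _ = _ := Finset.sum_congr rfl fun ℓ _ => by rw [dist1_regauge_eq]

/-! ## §3 The door: hFlat from its in-tube edition -/

/-- ★★★ **hFlat FROM hFlat-IN-THE-TUBE**: if the flat growth letter holds for the good histories over the flat datum ALL OF WHOSE BONDS ARE WITHIN `δ` OF `1` (for a `δ > 0` chosen first, per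
`L`), then it holds VERBATIM (the third hypothesis of ✓`…S2BetaGapOrbitOfStrata.uniformFibreGapOrbit_of_strata_of_flat`): regauge by the residual `w` of `flatSupTube`; the fibre of `1`,
`histGood`, the action and the regular minimum are invariant, and the orbit functional does not increase. [cite: Balaban1985RegularSpaces, Lemma 1 pp.79-80; Balaban1984PropagatorsII, (1.33)] -/
theorem hFlat_of_inTube
    (hTube : ∀ (L : ℕ), ∃ δ : ℝ, 0 < δ ∧ ∃ pS : ℝ, ∀ (b₀ p₀ : ℝ), 0 < b₀ → pS ≤ p₀ → 0 < p₀ → ∃ ε₁ : ℝ, 0 < ε₁ ∧ ∀ (ε₀ : ℝ), 0 < ε₀ → ε₀ ≤ ε₁ →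
      ∃ γ₁ : ℝ, 0 < γ₁ ∧ ∃ μ : ℝ, 0 < μ ∧ ∀ (F : T3Family) (γ : ℝ), F.L = L → 0 < γ → γ ≤ γ₁ →
        ∀ (J K : ℕ) (hlt : J < K),
          ∀ U ∈ fibre F ℰp J K hlt.le (1 : GaugeField (F.P J) 0 (Matrix.specialUnitaryGroup (Fin 2) ℂ)), U ∈ histGood F ℰp (θBal F.L γ b₀ p₀) K J →
            (∀ ℓ : PBond (F.P K) 0, dist1 (U ℓ) ≤ δ) →
            μ * ((F.L : ℝ)⁻¹) ^ (2 * (K - J)) *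
                (⨅ w : {w : Site (F.P K) 0 → Matrix.specialUnitaryGroup (Fin 2) ℂ |
                    ∀ U : GaugeField (F.P K) 0 (Matrix.specialUnitaryGroup (Fin 2) ℂ),
                      descendTo F ℰp J K hlt.le (GaugeField.gaugeAct w U) = descendTo F ℰp J K hlt.le U},
                  ∑ ℓ : PBond (F.P K) 0,
                    dist1 (U ℓ * ((GaugeField.gaugeAct (w : Site (F.P K) 0 → Matrix.specialUnitaryGroup (Fin 2) ℂ) (1 : GaugeField (F.P K) 0 (Matrix.specialUnitaryGroup (Fin 2) ℂ))) ℓ)⁻¹) ^ 2)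
              ≤ wilsonAction4 U - minActionRegPr F J K hlt.le ε₀ (1 : GaugeField (F.P J) 0 (Matrix.specialUnitaryGroup (Fin 2) ℂ))) :
    ∀ (L : ℕ), ∃ pS : ℝ, ∀ (b₀ p₀ : ℝ), 0 < b₀ → pS ≤ p₀ → 0 < p₀ → ∃ ε₁ : ℝ, 0 < ε₁ ∧ ∀ (ε₀ : ℝ), 0 < ε₀ → ε₀ ≤ ε₁ →
    ∃ γ₁ : ℝ, 0 < γ₁ ∧ ∃ μ : ℝ, 0 < μ ∧ ∀ (F : T3Family) (γ : ℝ), F.L = L → 0 < γ → γ ≤ γ₁ →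
      ∀ (J K : ℕ) (hlt : J < K),
        ∀ U ∈ fibre F ℰp J K hlt.le (1 : GaugeField (F.P J) 0 (Matrix.specialUnitaryGroup (Fin 2) ℂ)), U ∈ histGood F ℰp (θBal F.L γ b₀ p₀) K J →
          μ * ((F.L : ℝ)⁻¹) ^ (2 * (K - J)) *
              (⨅ w : {w : Site (F.P K) 0 → Matrix.specialUnitaryGroup (Fin 2) ℂ |
                  ∀ U : GaugeField (F.P K) 0 (Matrix.specialUnitaryGroup (Fin 2) ℂ),
                    descendTo F ℰp J K hlt.le (GaugeField.gaugeAct w U) = descendTo F ℰp J K hlt.le U},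
                ∑ ℓ : PBond (F.P K) 0,
                  dist1 (U ℓ * ((GaugeField.gaugeAct (w : Site (F.P K) 0 → Matrix.specialUnitaryGroup (Fin 2) ℂ) (1 : GaugeField (F.P K) 0 (Matrix.specialUnitaryGroup (Fin 2) ℂ))) ℓ)⁻¹) ^ 2)
            ≤ wilsonAction4 U - minActionRegPr F J K hlt.le ε₀ (1 : GaugeField (F.P J) 0 (Matrix.specialUnitaryGroup (Fin 2) ℂ)) := by
  intro L
  obtain ⟨δ, hδ, pS, hpS⟩ := hTube L
  refine ⟨pS, fun b₀ p₀ hb hpS' hp => ?_⟩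
  obtain ⟨ε₁, hε₁, hε⟩ := hpS b₀ p₀ hb hpS' hp
  refine ⟨ε₁, hε₁, fun ε₀ hε₀ hε₀1 => ?_⟩
  obtain ⟨γ₁, hγ₁, μ, hμ, hmain⟩ := hε ε₀ hε₀ hε₀1
  obtain ⟨γ₂, hγ₂, htube⟩ := flatSupTube L b₀ p₀ hb hp δ hδ
  refine ⟨min γ₁ γ₂, lt_min hγ₁ hγ₂, μ, hμ, fun F γ hFL hγ hγle J K hlt U hU hUg => ?_⟩
  obtain ⟨w, hw, hclose⟩ := htube F γ hFL hγ (hγle.trans (min_le_right _ _)) J K hlt.le U hU hUg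
  -- the regauged field `U₁ := w⁻¹ • U` is a good history over `1` with all bonds within `δ` of `1`
  have hw' := residual_inv F hlt.le hw
  have hU₁ : GaugeField.gaugeAct (w⁻¹ : Site (F.P K) 0 → Matrix.specialUnitaryGroup (Fin 2) ℂ) U ∈ fibre F ℰp J K hlt.le (1 : GaugeField (F.P J) 0 (Matrix.specialUnitaryGroup (Fin 2) ℂ)) :=
    (gaugeAct_mem_fibre_iff_of_residual F hlt.le hw' U 1).2 hU
  have hU₁g : GaugeField.gaugeAct (w⁻¹ : Site (F.P K) 0 → Matrix.specialUnitaryGroup (Fin 2) ℂ) U ∈ histGood F ℰp (θBal F.L γ b₀ p₀) K J := (gaugeAct_mem_histGood_iff F (w⁻¹ : Site (F.P K) 0 → Matrix.specialUnitaryGroup (Fin 2) ℂ) _ _ U).2 hUg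
  have hU₁δ : ∀ ℓ : PBond (F.P K) 0, dist1 (GaugeField.gaugeAct (w⁻¹ : Site (F.P K) 0 → Matrix.specialUnitaryGroup (Fin 2) ℂ) U ℓ) ≤ δ := by
    intro ℓ
    have e : GaugeField.gaugeAct (w⁻¹ : Site (F.P K) 0 → Matrix.specialUnitaryGroup (Fin 2) ℂ) U ℓ =
        (w ℓ.src)⁻¹ * (U ℓ * ((GaugeField.gaugeAct w (1 : GaugeField (F.P K) 0 (Matrix.specialUnitaryGroup (Fin 2) ℂ))) ℓ)⁻¹) * ((w ℓ.src)⁻¹)⁻¹ := by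
      show (w ℓ.src)⁻¹ * U ℓ * ((w ℓ.tgt)⁻¹)⁻¹ = (w ℓ.src)⁻¹ * (U ℓ * (w ℓ.src * 1 * (w ℓ.tgt)⁻¹)⁻¹) * ((w ℓ.src)⁻¹)⁻¹
      group
    rw [e, GaugeGroup.dist1_conj]
    exact hclose ℓ
  have h := hmain F γ hFL hγ (hγle.trans (min_le_left _ _)) J K hlt (GaugeField.gaugeAct (w⁻¹ : Site (F.P K) 0 → Matrix.specialUnitaryGroup (Fin 2) ℂ) U) hU₁ hU₁g hU₁δ
  rw [wilsonAction4_gaugeAct] at h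
  refine le_trans ?_ h
  have hL0 : (0 : ℝ) ≤ ((F.L : ℝ)⁻¹) ^ (2 * (K - J)) := by positivity
  exact mul_le_mul_of_nonneg_left (iInf_orbit_le_iInf_orbit_regauge F hlt.le U hw) (mul_nonneg hμ.le hL0)

end Summit.QuantumFields.YangMills.Theorems.FluctuationComparisonRegPrIntLS2BetaFlatTubeWLOG

end
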